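import Literature.Computability.AlgebraicComplexity.QuantumFunctionalsKroneckerProofs
import Literature.Computability.AlgebraicComplexity.QuantumFunctionalsSpectralPoint
import Literature.Computability.AlgebraicComplexity.QuantumFunctionalsDirectSumUpper
import HarnessLib

/-!
# CVZ Cor. 3.31 from Lemma 3.11 alone: the quantum functionals are universal spectral points once
# the upper functional is sub-additive

Topic `Literature/Computability/AlgebraicComplexity`; reduction file (theorems only) for the named fact
`ChristandlVranaZuiddam2023_universalSpectralPoint` (M. Christandl, P. Vrana, J. Zuiddam, *Universal
points in the asymptotic spectrum of tensors*, J. Amer. Math. Soc. 36 (2023) = arXiv:1709.07851v3,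
**Cor. 3.31**: `F_θ` is normalised on unit tensors, additive, multiplicative and restriction-monotone).
With Thm. 3.30 (`ChristandlVranaZuiddam2023_upper_eq_lower_holds`, `QuantumFunctionalsUpperEqLower.lean`)
and the multiplicativity (`ChristandlVranaZuiddam2023_kronecker_le_holds`,
`QuantumFunctionalsKroneckerProofs.lean`) now proved, the only ingredient of Cor. 3.31 that is still a
named fact is the sub-additivity of the upper functional, CVZ **Lemma 3.11**
(`ChristandlVranaZuiddam2023_upper_subadditive`, `QuantumFunctionalsUpper.lean`). This file records the
resulting one-hypothesis reductions:

* `ChristandlVranaZuiddam2023_directSum_subadditive_of_upper_subadditive` — Lemma 3.11 ⇒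
  `F_θ(s ⊕ t) ≤ F_θ(s) + F_θ(t)`;
* `ChristandlVranaZuiddam2023_directSum_of_upper_subadditive` — Lemma 3.11 ⇒ additivity (with the
  proved super-additivity, Lemma 3.22);
* `ChristandlVranaZuiddam2023_universalSpectralPoint_of_upper_subadditive` — Lemma 3.11 ⇒ Cor. 3.31.

No definitions, no named facts.

## References

* M. Christandl, P. Vrana, J. Zuiddam, J. Amer. Math. Soc. 36 (2023) 31–79 = arXiv:1709.07851v3,
  Lemma 3.11, Thm. 3.19, Lemma 3.22, Thm. 3.30, Cor. 3.31. [ChristandlVranaZuiddam2023]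
-/

noncomputable section

namespace Literature.Computability.AlgebraicComplexity

universe u

/-- **Lemma 3.11 ⇒ sub-additivity of `F_θ`** (with Thm. 3.30 proved).
[cite: ChristandlVranaZuiddam2023, Cor. 3.31] -/
theorem ChristandlVranaZuiddam2023_directSum_subadditive_of_upper_subadditive
    (h : ChristandlVranaZuiddam2023_upper_subadditive.{u}) :
    ChristandlVranaZuiddam2023_directSum_subadditive.{u} :=
  ChristandlVranaZuiddam2023_directSum_subadditive_of_upper h ChristandlVranaZuiddam2023_upper_eq_lower_holds

/-- **Lemma 3.11 ⇒ additivity of `F_θ`** (CVZ Cor. 3.31, with Lemma 3.22 and Thm. 3.30 proved).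
[cite: ChristandlVranaZuiddam2023, Cor. 3.31] -/
theorem ChristandlVranaZuiddam2023_directSum_of_upper_subadditive
    (h : ChristandlVranaZuiddam2023_upper_subadditive.{u}) :
    ChristandlVranaZuiddam2023_directSum.{u} :=
  ChristandlVranaZuiddam2023_directSum_of_subadditive
    (ChristandlVranaZuiddam2023_directSum_subadditive_of_upper_subadditive h)

/-- **Lemma 3.11 ⇒ Cor. 3.31**: once the upper quantum functional is sub-additive, the quantum
functionals `F_θ`, `θ ∈ P([3])`, are universal spectral points (normalisation, additivity,
multiplicativity, restriction-monotonicity), all other ingredients being proved in the tree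
(`ChristandlVranaZuiddam2023_unitTensor_holds`, `…_kronecker_le_holds`, `…_restriction_mono_holds`,
`…_upper_eq_lower_holds`, super-additivity). [cite: ChristandlVranaZuiddam2023, Cor. 3.31] -/
theorem ChristandlVranaZuiddam2023_universalSpectralPoint_of_upper_subadditive
    (h : ChristandlVranaZuiddam2023_upper_subadditive.{u}) :
    ChristandlVranaZuiddam2023_universalSpectralPoint.{u} :=
  ChristandlVranaZuiddam2023_universalSpectralPoint_of_halves
    (ChristandlVranaZuiddam2023_directSum_subadditive_of_upper_subadditive h)
    ChristandlVranaZuiddam2023_kronecker_le_holds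

end Literature.Computability.AlgebraicComplexity

end
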